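import Literature.AlgebraicGeometry.ComplexMultiplication.CyclotomicFermatCMTypesThreePrimeLevelSimple
import Literature.AlgebraicGeometry.ComplexMultiplication.CyclotomicFermatCMTypesTwoPrimeLevelMaximum
import HarnessLib

/-!
# Koblitz–Rohrlich's "Case 2. `m = 3` … Thus `s(N) ≤ 3/20`" (p. 1191): `40·#S₀(N) ≤ 3·φ(N)` at three-prime levels `N = pᵃqᵇrᶜ`, and
# REMARK 1's bound `s(N) ≤ 3/20 = s(55)` there

Layer `Literature/AlgebraicGeometry/ComplexMultiplication`, namespace `…ComplexMultiplication.CyclotomicFermatCMType`; sequel of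
`CyclotomicFermatCMTypesThreePrimeLevelSimple` (the per-prime bound `forty_mul_card_le`: `40·T_ℓ ≤ φ(pᵃ)φ(N_ℓ)`, each `s`-summand `≤ 1/20`) and
`CyclotomicFermatCMTypesTwoPrimeLevelMaximum` (`ω(N) ≤ 2`: `40·#S₀(N) ≤ 3φ(N)`, `<` iff `N ≠ 55`).  THEOREMS ONLY (no definition, no named fact,
no `sorry`).

THE SOURCE.  N. Koblitz, D. Rohrlich, *Simple factors in the Jacobian of a Fermat curve*, Canad. J. Math. **30** (1978) 1183–1205, §2, proof
of the Proposition (p. 1191): "Case 2. `m = 3`.  If `pᵢ = 5` or `7`, then for `j < 5` Table 1 shows that `pᵢʲ − 1` is not divisible by two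
distinct primes `≥ 5`.  Hence `ordᵢ ≥ 5` and `(pᵢ − 1)ordᵢ ≥ 20`.  If `pᵢ ≥ 11`, then by (1) and (2) also `(pᵢ − 1)ordᵢ ≥ 20`.  **Thus
`s(N) ≤ 3/20 < 1/6`.**" and REMARK 1 (p. 1192): "It is clear from the above proof that `3/20` is the maximum for `s(N)`."

The sibling `…ThreePrimeLevelSimple` recorded from Case 2 only the consequence `12·Σ_ℓ T_ℓ < φ(N)` it needed; THIS FILE records the printed
intermediate bound itself: §1 `forty_mul_sum_card_le_three_primes` (`40·Σ_{ℓ ∣ N} T_ℓ ≤ 3·φ(N)` for `N = pᵃqᵇrᶜ`, distinct primes `≥ 5` — three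
applications of the sibling's `forty_mul_card_le`), **`forty_mul_card_bad_le_three_primes`** (`40·#S₀(N) ≤ 3·φ(N)`), `s_le_three_div_twenty_three_primes`
(`s(N) ≤ 3/20` in `ℚ`) and `s_le_s_fiftyFive_three_primes` (`s(N) ≤ s(55)`) — so, with the sibling (`ω(N) ≤ 2`), Remark 1's bound holds
at every level prime to `6` with at most three prime factors.

## Honest column / NOT here

* Strictness `s(N) < 3/20` at three-prime levels (true numerically; Remark 1 says the maximum is attained at `55` only) is NOT typed — it needs a
  new argument that the three per-prime bounds cannot be simultaneously sharp; `ω(N) ≥ 4` (Cases 3–5 with the constant `3/20`) is NOT typed.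
* The §1 bookkeeping (prime factors `{p, q, r}`, the three `ordCompl`s and totient splittings) is a copy of the sibling's proof with the
  conclusion kept at `40·Σ ≤ 3φ`; private helpers are copies.

## References

* [KoblitzRohrlich1978] N. Koblitz, D. Rohrlich, Canad. J. Math. 30 (1978) 1183–1205: §2 Proposition, Case 2 (p. 1191), Remark 1 (p. 1192).

## Provenance

Cell `pub-hodgecm2` (COR-CM), literature seat `lit-deligne-3` gen 35 (claim KR78-MAXIMUM-3; count-neutral, own lane).
-/

noncomputable section

open NumberField

namespace Literature.AlgebraicGeometry.ComplexMultiplication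

open Literature.NumberTheory.ComplexMultiplication
open Literature.NumberTheory.LFunctions

namespace CyclotomicFermatCMType

/-! ## §1 Three-prime levels: `40·Σ T_ℓ ≤ 3·φ(N)`, `40·#S₀(N) ≤ 3·φ(N)`, `s(N) ≤ 3/20` -/

section ThreePrimes

/-- Transport of the side count along an equality of moduli (private copy of the siblings'). [folklore] -/
private theorem card_level_congr₃ (r : ℕ) {M M' : ℕ} (h : M = M') :
    Nat.card {ψ : DirichletCharacter ℂ M // ψ.Odd ∧ ψ (r : ZMod M) = 1} =
      Nat.card {ψ : DirichletCharacter ℂ M' // ψ.Odd ∧ ψ (r : ZMod M') = 1} := by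
  subst h
  rfl

/-- `ordCompl[p] (pᵃ·M) = M` for `p ∤ M` (private copy of the sibling's). [folklore] -/
private theorem ordCompl_pow_mul_of_not_dvd' {p a M : ℕ} (hp : p.Prime) (hM : ¬p ∣ M) : ordCompl[p] (p ^ a * M) = M := by
  rw [Nat.ordCompl_self_pow_mul M a hp, (Nat.ordCompl_eq_self_iff_zero_or_not_dvd _ hp).2 (Or.inr hM)]

/-- **"Thus `s(N) ≤ 3/20`" (Case 2, `m = 3`), structural form**: for `N = pᵃqᵇrᶜ` with distinct primes `p, q, r ≥ 5` and `a, b, c ≥ 1`,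
`40·Σ_{ℓ ∣ N} #{ψ mod N_ℓ odd : ψ(ℓ) = 1} ≤ 3·φ(N)` (each summand `T_ℓ` has `40·T_ℓ ≤ φ(N)`: the sibling's `forty_mul_card_le`).
[cite: KoblitzRohrlich1978, §2 Proposition, Case 2 (p. 1191)] -/
theorem forty_mul_sum_card_le_three_primes {p q r a b c N : ℕ} (hp : p.Prime) (hq : q.Prime) (hr : r.Prime)
    (hp5 : 5 ≤ p) (hq5 : 5 ≤ q) (hr5 : 5 ≤ r) (hpq : p ≠ q) (hpr : p ≠ r) (hqr : q ≠ r) (ha : a ≠ 0) (hb : b ≠ 0) (hc : c ≠ 0)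
    (hN : N = p ^ a * q ^ b * r ^ c) :
    40 * ∑ ℓ ∈ N.primeFactors,
        Nat.card {ψ : DirichletCharacter ℂ (ordCompl[ℓ] N) // ψ.Odd ∧ ψ (ℓ : ZMod (ordCompl[ℓ] N)) = 1} ≤ 3 * N.totient := by
  subst hN
  -- coprimalities
  have cpq : p.Coprime q := (Nat.coprime_primes hp hq).2 hpq
  have cpr : p.Coprime r := (Nat.coprime_primes hp hr).2 hpr
  have cqr : q.Coprime r := (Nat.coprime_primes hq hr).2 hqr
  haveI : NeZero (q ^ b * r ^ c) := ⟨Nat.pos_iff_ne_zero.1 (Nat.mul_pos (pow_pos hq.pos b) (pow_pos hr.pos c))⟩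
  haveI : NeZero (p ^ a * r ^ c) := ⟨Nat.pos_iff_ne_zero.1 (Nat.mul_pos (pow_pos hp.pos a) (pow_pos hr.pos c))⟩
  haveI : NeZero (p ^ a * q ^ b) := ⟨Nat.pos_iff_ne_zero.1 (Nat.mul_pos (pow_pos hp.pos a) (pow_pos hq.pos b))⟩
  -- prime factors and complementary parts
  have hpf : (p ^ a * q ^ b * r ^ c).primeFactors = {p, q, r} := by
    have hA : (p ^ a * q ^ b).Coprime (r ^ c) :=
      Nat.Coprime.mul_left ((cpr.pow_right c).pow_left a) ((cqr.pow_right c).pow_left b)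
    rw [Nat.Coprime.primeFactors_mul hA, Nat.Coprime.primeFactors_mul ((cpq.pow_right b).pow_left a),
      Nat.primeFactors_prime_pow ha hp, Nat.primeFactors_prime_pow hb hq, Nat.primeFactors_prime_pow hc hr]
    ext x
    simp
  have hnp : ¬p ∣ q ^ b * r ^ c := fun h => by
    rcases (Nat.Prime.dvd_mul hp).1 h with h1 | h1
    · exact hpq ((Nat.prime_dvd_prime_iff_eq hp hq).1 (hp.dvd_of_dvd_pow h1))
    · exact hpr ((Nat.prime_dvd_prime_iff_eq hp hr).1 (hp.dvd_of_dvd_pow h1))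
  have hnq : ¬q ∣ p ^ a * r ^ c := fun h => by
    rcases (Nat.Prime.dvd_mul hq).1 h with h1 | h1
    · exact hpq.symm ((Nat.prime_dvd_prime_iff_eq hq hp).1 (hq.dvd_of_dvd_pow h1))
    · exact hqr ((Nat.prime_dvd_prime_iff_eq hq hr).1 (hq.dvd_of_dvd_pow h1))
  have hnr : ¬r ∣ p ^ a * q ^ b := fun h => by
    rcases (Nat.Prime.dvd_mul hr).1 h with h1 | h1
    · exact hpr.symm ((Nat.prime_dvd_prime_iff_eq hr hp).1 (hr.dvd_of_dvd_pow h1))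
    · exact hqr.symm ((Nat.prime_dvd_prime_iff_eq hr hq).1 (hr.dvd_of_dvd_pow h1))
  have h1 : ordCompl[p] (p ^ a * q ^ b * r ^ c) = q ^ b * r ^ c := by
    rw [mul_assoc]
    exact ordCompl_pow_mul_of_not_dvd' hp hnp
  have h2 : ordCompl[q] (p ^ a * q ^ b * r ^ c) = p ^ a * r ^ c := by
    rw [show p ^ a * q ^ b * r ^ c = q ^ b * (p ^ a * r ^ c) by ring]
    exact ordCompl_pow_mul_of_not_dvd' hq hnq
  have h3 : ordCompl[r] (p ^ a * q ^ b * r ^ c) = p ^ a * q ^ b := by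
    rw [show p ^ a * q ^ b * r ^ c = r ^ c * (p ^ a * q ^ b) by ring]
    exact ordCompl_pow_mul_of_not_dvd' hr hnr
  -- the three per-prime bounds `40·T ≤ φ(N)`
  have hTp := forty_mul_card_le (M := q ^ b * r ^ c) hp hp5 ((hp.coprime_iff_not_dvd).2 hnp) hq hr hq5 hr5 hqr
    (dvd_mul_of_dvd_left (dvd_pow_self q hb) _) (dvd_mul_of_dvd_right (dvd_pow_self r hc) _) ha
  have hTq := forty_mul_card_le (M := p ^ a * r ^ c) hq hq5 ((hq.coprime_iff_not_dvd).2 hnq) hp hr hp5 hr5 hpr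
    (dvd_mul_of_dvd_left (dvd_pow_self p ha) _) (dvd_mul_of_dvd_right (dvd_pow_self r hc) _) hb
  have hTr := forty_mul_card_le (M := p ^ a * q ^ b) hr hr5 ((hr.coprime_iff_not_dvd).2 hnr) hp hq hp5 hq5 hpq
    (dvd_mul_of_dvd_left (dvd_pow_self p ha) _) (dvd_mul_of_dvd_right (dvd_pow_self q hb) _) hc
  -- the totient of `N` in the three splittings
  have hφ1 : (p ^ a * q ^ b * r ^ c).totient = (p ^ a).totient * (q ^ b * r ^ c).totient := by
    rw [mul_assoc, Nat.totient_mul (Nat.Coprime.mul_right ((cpq.pow_right b).pow_left a) ((cpr.pow_right c).pow_left a))]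
  have hφ2 : (p ^ a * q ^ b * r ^ c).totient = (q ^ b).totient * (p ^ a * r ^ c).totient := by
    rw [show p ^ a * q ^ b * r ^ c = q ^ b * (p ^ a * r ^ c) by ring,
      Nat.totient_mul (Nat.Coprime.mul_right ((cpq.symm.pow_right a).pow_left b) ((cqr.pow_right c).pow_left b))]
  have hφ3 : (p ^ a * q ^ b * r ^ c).totient = (r ^ c).totient * (p ^ a * q ^ b).totient := by
    rw [show p ^ a * q ^ b * r ^ c = r ^ c * (p ^ a * q ^ b) by ring,
      Nat.totient_mul (Nat.Coprime.mul_right ((cpr.symm.pow_right a).pow_left c) ((cqr.symm.pow_right b).pow_left c))]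
  have hmem1 : p ∉ ({q, r} : Finset ℕ) := by simp [hpq, hpr]
  have hmem2 : q ∉ ({r} : Finset ℕ) := by simp [hqr]
  rw [hpf, Finset.sum_insert hmem1, Finset.sum_insert hmem2, Finset.sum_singleton, card_level_congr₃ p h1,
    card_level_congr₃ q h2, card_level_congr₃ r h3]
  rw [← hφ1] at hTp
  rw [← hφ2] at hTq
  rw [← hφ3] at hTr
  omega

variable {p q r a b c N : ℕ} [NeZero N]

/-- **"Thus `s(N) ≤ 3/20`" at three-prime levels**: `40·#S₀(N) ≤ 3·φ(N)` for `N = pᵃqᵇrᶜ` (distinct primes `≥ 5`, `a, b, c ≥ 1`) — with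
`#S(N) = φ(N)/2` this is `#S₀(N)/#S(N) ≤ 3/20`. [cite: KoblitzRohrlich1978, §2 Proposition, Case 2 (p. 1191) and Remark 1 (p. 1192)] -/
theorem forty_mul_card_bad_le_three_primes (hp : p.Prime) (hq : q.Prime) (hr : r.Prime) (hp5 : 5 ≤ p) (hq5 : 5 ≤ q) (hr5 : 5 ≤ r)
    (hpq : p ≠ q) (hpr : p ≠ r) (hqr : q ≠ r) (ha : a ≠ 0) (hb : b ≠ 0) (hc : c ≠ 0) (hN : N = p ^ a * q ^ b * r ^ c) :
    40 * Nat.card {χ : DirichletCharacter ℂ N // χ.Odd ∧ bernoulliOneChar χ = 0} ≤ 3 * N.totient :=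
  le_trans (Nat.mul_le_mul_left _ card_odd_bernoulliOneChar_eq_zero_le)
    (forty_mul_sum_card_le_three_primes hp hq hr hp5 hq5 hr5 hpq hpr hqr ha hb hc hN)

/-- **`s(N) ≤ 3/20` at three-prime levels**, as a rational number. [cite: KoblitzRohrlich1978, §2 Proposition, Case 2 (p. 1191)] -/
theorem s_le_three_div_twenty_three_primes (hp : p.Prime) (hq : q.Prime) (hr : r.Prime) (hp5 : 5 ≤ p) (hq5 : 5 ≤ q) (hr5 : 5 ≤ r)
    (hpq : p ≠ q) (hpr : p ≠ r) (hqr : q ≠ r) (ha : a ≠ 0) (hb : b ≠ 0) (hc : c ≠ 0) (hN : N = p ^ a * q ^ b * r ^ c) :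
    (Nat.card {χ : DirichletCharacter ℂ N // χ.Odd ∧ bernoulliOneChar χ = 0} : ℚ) /
        Nat.card {χ : DirichletCharacter ℂ N // χ.Odd} ≤ 3 / 20 := by
  have hN2 : 2 < N := by
    rw [hN]
    calc 2 < 5 := by norm_num
      _ ≤ p := hp5
      _ = p ^ 1 := (pow_one p).symm
      _ ≤ p ^ a := Nat.pow_le_pow_right (by omega) (Nat.one_le_iff_ne_zero.2 ha)
      _ ≤ p ^ a * q ^ b := Nat.le_mul_of_pos_right _ (pow_pos hq.pos b)
      _ ≤ p ^ a * q ^ b * r ^ c := Nat.le_mul_of_pos_right _ (pow_pos hr.pos c)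
  have hS := two_mul_card_odd_eq_totient' (M := N) hN2
  have h := forty_mul_card_bad_le_three_primes hp hq hr hp5 hq5 hr5 hpq hpr hqr ha hb hc hN
  have hSpos : 0 < Nat.card {χ : DirichletCharacter ℂ N // χ.Odd} := by
    have := Nat.totient_pos.2 (NeZero.pos N)
    omega
  rw [div_le_div_iff₀ (by exact_mod_cast hSpos) (by norm_num)]
  have h' : (40 : ℚ) * Nat.card {χ : DirichletCharacter ℂ N // χ.Odd ∧ bernoulliOneChar χ = 0} ≤
      3 * (2 * Nat.card {χ : DirichletCharacter ℂ N // χ.Odd}) := by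
    rw [show (3 : ℚ) * (2 * Nat.card {χ : DirichletCharacter ℂ N // χ.Odd}) = 3 * ((2 * Nat.card {χ : DirichletCharacter ℂ N // χ.Odd} : ℕ) : ℚ)
      by push_cast; ring, hS]
    exact_mod_cast h
  linarith

/-- **`s(N) ≤ s(55)` at three-prime levels** (Remark 1's maximum). [cite: KoblitzRohrlich1978, §2 Remark 1 (p. 1192)] -/
theorem s_le_s_fiftyFive_three_primes (hp : p.Prime) (hq : q.Prime) (hr : r.Prime) (hp5 : 5 ≤ p) (hq5 : 5 ≤ q) (hr5 : 5 ≤ r)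
    (hpq : p ≠ q) (hpr : p ≠ r) (hqr : q ≠ r) (ha : a ≠ 0) (hb : b ≠ 0) (hc : c ≠ 0) (hN : N = p ^ a * q ^ b * r ^ c) :
    (Nat.card {χ : DirichletCharacter ℂ N // χ.Odd ∧ bernoulliOneChar χ = 0} : ℚ) /
        Nat.card {χ : DirichletCharacter ℂ N // χ.Odd} ≤
      (Nat.card {χ : DirichletCharacter ℂ 55 // χ.Odd ∧ bernoulliOneChar χ = 0} : ℚ) /
        Nat.card {χ : DirichletCharacter ℂ 55 // χ.Odd} := by
  rw [s_fiftyFive]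
  exact s_le_three_div_twenty_three_primes hp hq hr hp5 hq5 hr5 hpq hpr hqr ha hb hc hN

end ThreePrimes

end CyclotomicFermatCMType

end Literature.AlgebraicGeometry.ComplexMultiplication
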